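import Summits.QuantumFields.QCD.Theorems.QuarksAsStableActionCriticalLineDiamagnetismRectFreqOpDefs

/-!
# Route B infrastructure for stub `stub_heavyFrequencyGain` of line `Sketch` — reflection covariance of the 2D frequency
determinant on RECTANGULAR two-tori
(crux `Summit.QuantumFields.QCD.Theses.QuarksAsStableAction.CriticalLineDiamagnetism`, item stmt-QuantumFields-9734,
static route for odd tori, Route B of the heavy-frequency gain)

Two-length copy of `freqOp_submatrix_transpose` / `det_freqOp_transpose` of `…StubFrequencyDiamagnetismAux1`: exchanging the
two coordinates, the two link directions and the spin slots `2 ↔ 3` reindexes the frequency operator of `ℤ/L₁ × ℤ/L₂` into the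
one of `ℤ/L₂ × ℤ/L₁` (`freqOpR_submatrix_transpose`); undoing `(2 3) = (0 2)(0 3)(0 2)` on the spin slots by three conjugations
(`det_freqOpR_swap`) gives `det D_{L₁×L₂}[A] = det D_{L₂×L₁}[Aᵀ]`, `Aᵀ b a μ = A a b ((2 3) μ)` (`det_freqOpR_transpose`,
registered as `rectDetTranspose`) — which turns the transfer-matrix machinery along the first coordinate into the one along
the second.
-/

noncomputable section

open scoped BigOperators Matrix ComplexConjugate
open Finset
open Literature.MathematicalPhysics.QuantumLattice Literature.MathematicalPhysics.QuantumFieldTheory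
  Literature.Probability.LatticeModels

namespace Summit.QuantumFields.QCD.Cruxes.CriticalLineDiamagnetism.ChessboardCellGain

namespace FrequencyDiamagnetism

open Matrix Complex

/-- **Exchanging the two coordinates, the two link directions and the spin slots `2 ↔ 3` reindexes the frequency operator
of `ℤ/L₁ × ℤ/L₂` into the one of `ℤ/L₂ × ℤ/L₁`.** -/
theorem freqOpR_submatrix_transpose {L₁ L₂ : ℕ} (g : Fin 4 → Matrix (Fin 4) (Fin 4) ℂ)
    (A : ZMod L₁ → ZMod L₂ → Fin 4 → Matrix.unitaryGroup (Fin 3) ℂ) (m ω₀ ω₁ : ℝ) :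
    (freqOpR g A m ω₀ ω₁).submatrix
        (fun p : (ZMod L₂ × ZMod L₁) × Fin 3 × Fin 4 => ((p.1.2, p.1.1), p.2))
        (fun p : (ZMod L₂ × ZMod L₁) × Fin 3 × Fin 4 => ((p.1.2, p.1.1), p.2)) =
      freqOpR (fun μ => g (Equiv.swap (2 : Fin 4) 3 μ))
        (fun (b : ZMod L₂) (a : ZMod L₁) (μ : Fin 4) => A a b (Equiv.swap (2 : Fin 4) 3 μ)) m ω₀ ω₁ := by
  -- adapted from `freqOp_submatrix_transpose` (…StubFrequencyDiamagnetismAux1.lean)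
  have h0 : Equiv.swap (2 : Fin 4) 3 0 = 0 := by decide
  have h1 : Equiv.swap (2 : Fin 4) 3 1 = 1 := by decide
  have h2 : Equiv.swap (2 : Fin 4) 3 2 = 3 := by decide
  have h3 : Equiv.swap (2 : Fin 4) 3 3 = 2 := by decide
  ext ⟨⟨a, b⟩, c, α⟩ ⟨⟨d, e⟩, f, β⟩
  simp only [freqOpR, Matrix.submatrix_apply, Matrix.of_apply, h0, h1, h2, h3, Prod.mk.injEq]
  simp only [and_comm, and_assoc]
  ring

/-- **The rectangular frequency determinant is invariant under the diagonal reflection**: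
`det D_{L₁×L₂}[A] = det D_{L₂×L₁}[Aᵀ]` with `Aᵀ b a μ = A a b ((2 3) μ)`. -/
theorem det_freqOpR_transpose {L₁ L₂ : ℕ} [NeZero L₁] [NeZero L₂]
    (A : ZMod L₁ → ZMod L₂ → Fin 4 → Matrix.unitaryGroup (Fin 3) ℂ) (m ω₀ ω₁ : ℝ) :
    (freqOpR euclideanGamma A m ω₀ ω₁).det =
      (freqOpR euclideanGamma (fun (b : ZMod L₂) (a : ZMod L₁) (μ : Fin 4) => A a b (Equiv.swap (2 : Fin 4) 3 μ))
        m ω₀ ω₁).det := by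
  -- adapted from `det_freqOp_transpose` (…StubFrequencyDiamagnetismAux1.lean)
  -- reindex
  have h1 : (freqOpR euclideanGamma A m ω₀ ω₁).det =
      (freqOpR (fun μ => euclideanGamma (Equiv.swap (2 : Fin 4) 3 μ))
        (fun (b : ZMod L₂) (a : ZMod L₁) (μ : Fin 4) => A a b (Equiv.swap (2 : Fin 4) 3 μ)) m ω₀ ω₁).det := by
    rw [← freqOpR_submatrix_transpose]
    exact (Matrix.det_submatrix_equiv_self
      ((Equiv.prodComm (ZMod L₂) (ZMod L₁)).prodCongr (Equiv.refl (Fin 3 × Fin 4))) _).symm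
  -- undo `(2 3) = (0 2)(0 3)(0 2)` on the spin slots by three conjugations
  have h2 : (euclideanGamma : Fin 4 → Matrix (Fin 4) (Fin 4) ℂ) = fun μ => euclideanGamma
      (Equiv.swap (0 : Fin 4) 2 (Equiv.swap (0 : Fin 4) 3 (Equiv.swap (0 : Fin 4) 2 (Equiv.swap (2 : Fin 4) 3 μ)))) := by
    funext μ
    congr 1
    revert μ
    decide
  have h20 : (2 : Fin 4) ≠ 0 := by decide
  have h30 : (3 : Fin 4) ≠ 0 := by decide
  rw [h1]
  conv_rhs => rw [h2]
  rw [det_freqOpR_swap h20 (fun μ => Equiv.swap (0 : Fin 4) 3 (Equiv.swap (0 : Fin 4) 2 (Equiv.swap (2 : Fin 4) 3 μ))),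
    det_freqOpR_swap h30 (fun μ => Equiv.swap (0 : Fin 4) 2 (Equiv.swap (2 : Fin 4) 3 μ)),
    det_freqOpR_swap h20 (fun μ => Equiv.swap (2 : Fin 4) 3 μ)]

end FrequencyDiamagnetism

/-! ### Registered auxiliary theorem -/

/-- **Aux stub `rectDetTranspose`** (reflection covariance of the 2D frequency determinant on rectangular two-tori): for every
field `A : ℤ/L₁ → ℤ/L₂ → Fin 4 → U(3)`, mass `m` and real frequency pair, `det D_{L₁×L₂}[A] = det D_{L₂×L₁}[Aᵀ]` where the
reflected field `Aᵀ b a μ = A a b ((2 3) μ)` on `ℤ/L₂ × ℤ/L₁` exchanges the two coordinates and the two link directions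
(`D = freqOpR euclideanGamma`). -/
theorem rectDetTranspose : ∀ (L₁ L₂ : ℕ) [NeZero L₁] [NeZero L₂] (A : ZMod L₁ → ZMod L₂ → Fin 4 → Matrix.unitaryGroup (Fin 3) ℂ) (m ω₀ ω₁ : ℝ), (FrequencyDiamagnetism.freqOpR euclideanGamma A m ω₀ ω₁).det = (FrequencyDiamagnetism.freqOpR euclideanGamma (fun (b : ZMod L₂) (a : ZMod L₁) (μ : Fin 4) => A a b (Equiv.swap (2 : Fin 4) 3 μ)) m ω₀ ω₁).det :=
  fun _ _ _ _ A m ω₀ ω₁ => FrequencyDiamagnetism.det_freqOpR_transpose A m ω₀ ω₁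

end Summit.QuantumFields.QCD.Cruxes.CriticalLineDiamagnetism.ChessboardCellGain

end
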